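import Literature.NumberTheory.Automorphic.ParallelWeightCentralCharacter
import Literature.NumberTheory.Automorphic.BorelStabilizerLattice
import Literature.NumberTheory.Automorphic.HidaTowerDiamondCentre
import HarnessLib

/-!
# The central Hecke eigensystem of a cohomology class is an algebraic Größencharakter

Topic `NumberTheory/Automorphic`; namespace `Literature.NumberTheory.Automorphic`, grouping
sub-namespaces `BigHeckeGLn` (central ideles in `GL_n(𝔸_F^∞)`) and `ParallelWeight`.
Theorems only.

Let `ξ ≠ 0` be a class in `H^q(X_U, Ṽ_wt(E))` (`ParallelWeight.cohomology E F n wt U q`) which is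
an eigenvector of the CENTRAL Hecke operators `T_{w,n} = T_{ϖ_w · 1}` with eigenvalues `a(w)` for
all `w` outside a set `S`, and let `K_f(𝔫) ≤ U`.  For non-zero `b, c ∈ 𝓞_F` prime to `S` and to
`𝔫` with `b ≡ c (mod 𝔫)` (`centralEigensystem_idealPow_mul_eq`):

  `(∏_w a(w)^{ord_w b}) · ω_wt(c) = (∏_w a(w)^{ord_w c}) · ω_wt(b)`,

where `ω_wt(x) = ∏_{τ : F → E} ((τ x)^n)^{lowest wt} (τ x)^{deg wt}` is the central character of
`V_wt` (`ParallelWeightCentralCharacter.coeffRep_scalar`).  That is, `w ↦ a(w)` is an algebraic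
Größencharakter modulo `𝔫 · S` of infinity type given by `ω_wt` — the central character of the
eigensystem.  Proof: the global scalar `x · 1` acts on `H^q` by `ω_wt(x)` (central elements of `Γ`
act trivially on group cohomology, `heckeOp_globalScalar`); adelically
`x · 1 = (∏_w t_{w,n}^{ord_w x}) · u_x` with `u_x` a central integral idele (the vocabulary of
`TameLevelScalarFactorisation`: `centralLocal`, `localScalar`, `ordAt`), `u_c⁻¹ u_b ∈ K_f(𝔫)`;
central Hecke operators are multiplicative and those of central elements of the level are trivial
(`TwistedCentralHecke`). [cite: Harder1987, §2]

## References

* G. Harder, *Eisenstein cohomology of arithmetic groups. The case GL₂*, Invent. Math. 89 (1987), §2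
  [Harder1987].
* J. Neukirch, *Algebraic Number Theory* (1999), Ch. VII §6 (Größencharaktere) [NeukirchANT1999].
-/

noncomputable section

open scoped NumberField
open IsDedekindDomain NumberField

namespace Literature.NumberTheory.Automorphic

/-! ### Central ideles of `GL_n(𝔸_F^∞)` -/

namespace BigHeckeGLn

variable {n : ℕ} {K : Type} [Field K] [NumberField K]

/-- A constant diagonal of a local unit congruent to `1` lies in `K_v(r)`. [folklore] -/
theorem glDiagonal_const_mem_valuedCongruenceSubgroup {L : Type*} [Field L] {Γ₀ : Type*}
    [LinearOrderedCommGroupWithZero Γ₀] [Valued L Γ₀] {r : Γ₀} {u : Lˣ}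
    (hu : Valued.v (u : L) ≤ 1) (hu' : Valued.v ((u⁻¹ : Lˣ) : L) ≤ 1)
    (hr : Valued.v ((u : L) - 1) ≤ r) :
    glDiagonal n L (fun _ => u) ∈ valuedCongruenceSubgroup (Fin n) r := by
  refine ⟨fun i j => ?_, fun i j => ?_, fun i j => ?_⟩
  · rw [coe_glDiagonal, Matrix.diagonal_apply]
    split_ifs
    · exact hu
    · simp
  · rw [← map_inv, coe_glDiagonal, Matrix.diagonal_apply]
    split_ifs
    · exact hu'
    · simp
  · rw [Matrix.sub_apply, coe_glDiagonal, Matrix.diagonal_apply, Matrix.one_apply]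
    split_ifs
    · exact hr
    · simp

/-- `|b - c|_v ≤ |𝔫|_v` when `b - c ∈ 𝔫 ≠ 0`. [folklore] -/
theorem valuation_sub_le_idealRadius {𝔫 : Ideal (𝓞 K)} (h𝔫 : 𝔫 ≠ 0) {b c : 𝓞 K} (hbc : b - c ∈ 𝔫)
    (v : HeightOneSpectrum (𝓞 K)) :
    v.valuation K ((b : K) - c) ≤ idealRadius K v 𝔫 := by
  classical
  rw [show ((b : K) - c) = algebraMap (𝓞 K) K (b - c) by simp, v.valuation_of_algebraMap]
  set e : ℕ := (Associates.mk v.asIdeal).count (Associates.mk 𝔫).factors with he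
  have hrad : idealRadius K v 𝔫 = WithZero.exp (-(e : ℤ)) := by
    rw [idealRadius, FractionalIdeal.count_coe K v h𝔫]
  rw [hrad, HeightOneSpectrum.intValuation_le_pow_iff_mem]
  have hdvd : v.asIdeal ^ e ∣ 𝔫 := by
    rw [← Associates.mk_le_mk_iff_dvd, Associates.mk_pow]
    exact (Associates.prime_pow_dvd_iff_le (Associates.mk_ne_zero.mpr h𝔫)
      v.associates_irreducible).mpr le_rfl
  exact Ideal.le_of_dvd hdvd hbc

/-- **The central idele of a non-zero integer**: `Z_x = ∏_{w ∣ x} t_{w,n}^{ord_w x}` (product over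
the prime factors of `(x)`, as a list product of local elements). [folklore] -/
def centralIdeleOf (x : 𝓞 K) (hx : x ≠ 0) : FiniteAdelicGL n K :=
  (((Ideal.finite_factors (I := Ideal.span {x})
      (by rw [Ne, Ideal.zero_eq_bot, Ideal.span_singleton_eq_bot]; exact hx)).toFinset.toList).map
    fun w => ofLocal n K w (centralLocal x w)).prod

/-- A list product of central elements is central. [folklore] -/
theorem list_prod_mem_center {G : Type*} [Group G] :
    ∀ l : List G, (∀ g ∈ l, g ∈ Subgroup.center G) → l.prod ∈ Subgroup.center G
  | [], _ => by rw [List.prod_nil]; exact Subgroup.one_mem _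
  | g :: l, h => by
    rw [List.prod_cons]
    exact mul_mem (h g List.mem_cons_self) (list_prod_mem_center l fun x hx => h x (List.mem_cons_of_mem g hx))

/-- `Z_x` is central. [folklore] -/
theorem centralIdeleOf_mem_center (x : 𝓞 K) (hx : x ≠ 0) :
    centralIdeleOf (n := n) x hx ∈ Subgroup.center (FiniteAdelicGL n K) := by
  refine list_prod_mem_center _ fun g hg => ?_
  obtain ⟨w, -, rfl⟩ := List.mem_map.1 hg
  rw [ofLocal_centralLocal]
  exact pow_mem (heckeElement_self_mem_center w) _

/-- Local components of `Z_x`: `(ϖ_v · 1)^{ord_v x}` (trivial off the support). [folklore] -/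
theorem localComponent_centralIdeleOf (x : 𝓞 K) (hx : x ≠ 0) (v : HeightOneSpectrum (𝓞 K)) :
    localComponent n K v (centralIdeleOf x hx) = centralLocal x v := by
  classical
  rw [centralIdeleOf, localComponent_list_prod_ofLocal v (centralLocal x) _ (Finset.nodup_toList _)]
  split_ifs with h
  · rfl
  · rw [Finset.mem_toList, Set.Finite.mem_toFinset] at h
    have h0 : ordAt v x = 0 := by
      by_contra h'
      exact h ((ordAt_ne_zero_iff v hx).1 h')
    rw [centralLocal, h0, pow_zero]

/-- **The unit part `u_x = (x · 1) Z_x⁻¹` has UNIT local components**. [folklore] -/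
theorem valued_unitPart (x : 𝓞 K) (hx : x ≠ 0) (v : HeightOneSpectrum (𝓞 K)) :
    Valued.v (((Units.map (algebraMap K (v.adicCompletion K) : K →* v.adicCompletion K) (unitOf x hx) *
        ((uniformizerAt v) ^ ordAt v x)⁻¹ : (v.adicCompletion K)ˣ) : v.adicCompletion K)) = 1 := by
  rw [Units.val_mul, Units.val_inv_eq_inv_val, Units.val_pow_eq_pow_val, map_mul, map_inv₀, map_pow,
    valued_coe_uniformizerAt, Units.coe_map, MonoidHom.coe_coe]
  change Valued.v (algebraMap K (v.adicCompletion K) (x : K)) * _ = 1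
  rw [valued_algebraMap_eq v hx, ← WithZero.exp_nsmul, ← WithZero.exp_neg, ← WithZero.exp_add]
  simp

/-- The local component of the unit part is the constant diagonal of that unit. [folklore] -/
theorem localComponent_unitPart (x : 𝓞 K) (hx : x ≠ 0) (v : HeightOneSpectrum (𝓞 K)) :
    localComponent n K v (globalEmbedding n K (Matrix.GeneralLinearGroup.scalar (Fin n) (unitOf x hx)) *
        (centralIdeleOf x hx)⁻¹) =
      glDiagonal n (v.adicCompletion K) fun _ =>
        Units.map (algebraMap K (v.adicCompletion K) : K →* v.adicCompletion K) (unitOf x hx) *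
          ((uniformizerAt v) ^ ordAt v x)⁻¹ := by
  rw [map_mul, map_inv, localComponent_centralIdeleOf, localComponent_globalEmbedding_scalar,
    localScalar, centralLocal, cutDiag_self, ← map_pow, ← map_inv, ← map_mul]
  rfl

end BigHeckeGLn

/-! ### The central eigensystem -/

namespace ParallelWeight

open BigHeckeGLn

variable {E : Type} [Field E] {F : Type} [Field F] [NumberField F] {n : ℕ} {wt : Fin n → ℤ}
  {U : Subgroup (BigHeckeGLn.FiniteAdelicGL n F)} {q : ℕ}

/-- **Central eigenvalues are non-zero** (the central operators are invertible). [folklore] -/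
theorem centralEigenvalue_ne_zero {ξ : cohomology E F n wt U q} (hξ : ξ ≠ 0)
    {w : HeightOneSpectrum (𝓞 F)} {a : E}
    (h : heckeOp E F n wt U q (heckeElement n F w n) ξ = a • ξ) : a ≠ 0 := by
  intro ha
  rw [ha, zero_smul] at h
  have hz := heckeElement_self_mem_center (n := n) (K := F) w
  have h1 : heckeOp E F n wt U q ((heckeElement n F w n)⁻¹ * heckeElement n F w n) ξ = ξ := by
    rw [inv_mul_cancel]
    exact heckeOp_eq_self_of_mem_center_of_mem E F n wt U q (Subgroup.one_mem _) (one_mem U) ξ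
  rw [heckeOp_mul_of_mem_center E F n wt U q (inv_mem hz) hz, h, map_zero] at h1
  exact hξ h1.symm

/-- Powers of a central operator on an eigenvector. [folklore] -/
theorem heckeOp_pow_central_apply {g : FiniteAdelicGL n F} (hg : g ∈ Subgroup.center _)
    {ξ : cohomology E F n wt U q} {a : E} (h : heckeOp E F n wt U q g ξ = a • ξ) (k : ℕ) :
    heckeOp E F n wt U q (g ^ k) ξ = a ^ k • ξ := by
  induction k with
  | zero =>
    rw [pow_zero, pow_zero, one_smul]
    exact heckeOp_eq_self_of_mem_center_of_mem E F n wt U q (Subgroup.one_mem _) (one_mem U) ξ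
  | succ k ih =>
    rw [pow_succ, heckeOp_mul_of_mem_center E F n wt U q (pow_mem hg k) hg, h, map_smul, ih,
      smul_smul, pow_succ, mul_comm]

/-- **A list product of powers of central operators** acts on a simultaneous eigenvector by the
product of the powers of the eigenvalues. [folklore] -/
theorem heckeOp_list_prod_central_apply (e : HeightOneSpectrum (𝓞 F) → ℕ)
    {ξ : cohomology E F n wt U q} {a : HeightOneSpectrum (𝓞 F) → E} :
    ∀ l : List (HeightOneSpectrum (𝓞 F)),
      (∀ w ∈ l, heckeOp E F n wt U q (heckeElement n F w n) ξ = a w • ξ) →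
      heckeOp E F n wt U q ((l.map fun w => heckeElement n F w n ^ e w).prod) ξ =
        (l.map fun w => a w ^ e w).prod • ξ
  | [], _ => by
    rw [List.map_nil, List.map_nil, List.prod_nil, List.prod_nil, one_smul]
    exact heckeOp_eq_self_of_mem_center_of_mem E F n wt U q (Subgroup.one_mem _) (one_mem U) ξ
  | w :: l, h => by
    rw [List.map_cons, List.map_cons, List.prod_cons, List.prod_cons,
      heckeOp_mul_of_mem_center E F n wt U q (pow_mem (heckeElement_self_mem_center w) _)
        (list_prod_mem_center _ fun g hg => by
          obtain ⟨v, -, rfl⟩ := List.mem_map.1 hg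
          exact pow_mem (heckeElement_self_mem_center v) _),
      heckeOp_list_prod_central_apply e l (fun v hv => h v (List.mem_cons_of_mem w hv)), map_smul,
      heckeOp_pow_central_apply (heckeElement_self_mem_center w) (h w List.mem_cons_self),
      smul_smul, mul_comm]

/-- The eigenvalue product `A(x) = ∏_{w ∣ x} a(w)^{ord_w x}` (as a list product over the prime
factors of `(x)`). [folklore] -/
def eigenvalueProd (a : HeightOneSpectrum (𝓞 F) → E) (x : 𝓞 F) (hx : x ≠ 0) : E :=
  (((Ideal.finite_factors (I := Ideal.span {x})
      (by rw [Ne, Ideal.zero_eq_bot, Ideal.span_singleton_eq_bot]; exact hx)).toFinset.toList).map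
    fun w => a w ^ ordAt w x).prod

/-- **`T_{Z_x} ξ = A(x) ξ`** for `x` prime to `S`. [folklore] -/
theorem heckeOp_centralIdeleOf_apply {S : Set (HeightOneSpectrum (𝓞 F))}
    {ξ : cohomology E F n wt U q} {a : HeightOneSpectrum (𝓞 F) → E}
    (heig : ∀ w, w ∉ S → heckeOp E F n wt U q (heckeElement n F w n) ξ = a w • ξ)
    (x : 𝓞 F) (hx : x ≠ 0) (hxS : ∀ w, w.asIdeal ∣ Ideal.span {x} → w ∉ S) :
    heckeOp E F n wt U q (centralIdeleOf x hx) ξ = eigenvalueProd a x hx • ξ := by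
  have hI : Ideal.span {x} ≠ 0 := by rw [Ne, Ideal.zero_eq_bot, Ideal.span_singleton_eq_bot]; exact hx
  have heq : (centralIdeleOf (n := n) x hx) =
      (((Ideal.finite_factors hI).toFinset.toList).map fun w => heckeElement n F w n ^ ordAt w x).prod := by
    rw [centralIdeleOf]
    congr 1
    refine List.map_congr_left fun w _ => ?_
    exact ofLocal_centralLocal x w
  rw [heq, eigenvalueProd]
  exact heckeOp_list_prod_central_apply _ _ fun w hw => heig w (hxS w
    ((Ideal.finite_factors hI).mem_toFinset.1 (Finset.mem_toList.1 hw)))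

/-- `A(x) ≠ 0`. [folklore] -/
theorem eigenvalueProd_ne_zero {S : Set (HeightOneSpectrum (𝓞 F))}
    {ξ : cohomology E F n wt U q} (hξ : ξ ≠ 0) {a : HeightOneSpectrum (𝓞 F) → E}
    (heig : ∀ w, w ∉ S → heckeOp E F n wt U q (heckeElement n F w n) ξ = a w • ξ)
    (x : 𝓞 F) (hx : x ≠ 0) (hxS : ∀ w, w.asIdeal ∣ Ideal.span {x} → w ∉ S) :
    eigenvalueProd a x hx ≠ 0 := by
  have hI : Ideal.span {x} ≠ 0 := by rw [Ne, Ideal.zero_eq_bot, Ideal.span_singleton_eq_bot]; exact hx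
  rw [eigenvalueProd]
  refine List.prod_ne_zero fun h0 => ?_
  obtain ⟨w, hw, hw0⟩ := List.mem_map.1 h0
  have hwS := hxS w ((Ideal.finite_factors hI).mem_toFinset.1 (Finset.mem_toList.1 hw))
  exact pow_ne_zero _ (centralEigenvalue_ne_zero hξ (heig w hwS)) hw0

variable [CharZero E]

/-- The central character of `V_wt` at `x ∈ Fˣ`. [folklore] -/
def centralWeight (n : ℕ) (wt : Fin n → ℤ) (x : Fˣ) : E :=
  ∏ τ : F →+* E, ((((Units.map (τ : F →* E) x) ^ n) ^ GLnCohomology.lowestEntry wt : Eˣ) : E) *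
    (τ x) ^ GLnCohomology.coeffDegree wt

/-- **`T_{x · 1} ξ = ω_wt(x) ξ`.** [cite: Harder1987, §2] -/
theorem heckeOp_globalScalar_unitOf (ξ : cohomology E F n wt U q) (x : 𝓞 F) (hx : x ≠ 0) :
    heckeOp E F n wt U q (globalEmbedding n F (Matrix.GeneralLinearGroup.scalar (Fin n) (unitOf x hx))) ξ =
      centralWeight (E := E) n wt (unitOf x hx) • ξ :=
  heckeOp_globalScalar E F n wt U q (unitOf x hx) ξ

/-- **`T_{u_x} ξ = ω_wt(x) A(x)⁻¹ ξ`** for the unit part `u_x = (x · 1) Z_x⁻¹`. [folklore] -/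
theorem heckeOp_unitPart_apply {S : Set (HeightOneSpectrum (𝓞 F))}
    {ξ : cohomology E F n wt U q} (hξ : ξ ≠ 0) {a : HeightOneSpectrum (𝓞 F) → E}
    (heig : ∀ w, w ∉ S → heckeOp E F n wt U q (heckeElement n F w n) ξ = a w • ξ)
    (x : 𝓞 F) (hx : x ≠ 0) (hxS : ∀ w, w.asIdeal ∣ Ideal.span {x} → w ∉ S) :
    heckeOp E F n wt U q (globalEmbedding n F (Matrix.GeneralLinearGroup.scalar (Fin n) (unitOf x hx)) *
        (centralIdeleOf x hx)⁻¹) ξ =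
      (centralWeight (E := E) n wt (unitOf x hx) * (eigenvalueProd a x hx)⁻¹) • ξ := by
  have hZ := centralIdeleOf_mem_center (n := n) x hx
  have hA0 := eigenvalueProd_ne_zero hξ heig x hx hxS
  have hinv : heckeOp E F n wt U q ((centralIdeleOf x hx)⁻¹) ξ = (eigenvalueProd a x hx)⁻¹ • ξ := by
    have h := heckeOp_mul_of_mem_center E F n wt U q (inv_mem hZ) hZ ξ
    rw [inv_mul_cancel, heckeOp_eq_self_of_mem_center_of_mem E F n wt U q (Subgroup.one_mem _)
      (one_mem U), heckeOp_centralIdeleOf_apply heig x hx hxS, map_smul] at h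
    have h' := congrArg (fun y => (eigenvalueProd a x hx)⁻¹ • y) h
    simp only [smul_smul, inv_mul_cancel₀ hA0, one_smul] at h'
    exact h'.symm
  have hcomm : globalEmbedding n F (Matrix.GeneralLinearGroup.scalar (Fin n) (unitOf x hx)) *
      (centralIdeleOf x hx)⁻¹ =
      (centralIdeleOf x hx)⁻¹ * globalEmbedding n F (Matrix.GeneralLinearGroup.scalar (Fin n) (unitOf x hx)) :=
    Subgroup.mem_center_iff.1 (inv_mem hZ) _
  rw [hcomm, heckeOp_mul_of_mem_center E F n wt U q (inv_mem hZ) (globalEmbedding_scalar_mem_center _),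
    heckeOp_globalScalar_unitOf, map_smul, hinv, smul_smul, mul_comm]

/-- **The unit parts of congruent integers differ by an element of `K_f(𝔫)`.** For non-zero
`b, c` whose prime factors do not divide `𝔫` and with `b - c ∈ 𝔫`: `u_c⁻¹ u_b ∈ K_f(𝔫)`.
[folklore] -/
theorem unitPart_quotient_mem {𝔫 : Ideal (𝓞 F)} (h𝔫 : 𝔫 ≠ 0) {b c : 𝓞 F} (hb : b ≠ 0) (hc : c ≠ 0)
    (hb𝔫 : ∀ w : HeightOneSpectrum (𝓞 F), w.asIdeal ∣ Ideal.span {b} → ¬ w.asIdeal ∣ 𝔫)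
    (hc𝔫 : ∀ w : HeightOneSpectrum (𝓞 F), w.asIdeal ∣ Ideal.span {c} → ¬ w.asIdeal ∣ 𝔫) (hbc : b - c ∈ 𝔫) :
    (globalEmbedding n F (Matrix.GeneralLinearGroup.scalar (Fin n) (unitOf c hc)) *
        (centralIdeleOf c hc)⁻¹)⁻¹ *
      (globalEmbedding n F (Matrix.GeneralLinearGroup.scalar (Fin n) (unitOf b hb)) *
        (centralIdeleOf b hb)⁻¹) ∈
      (principalCongruenceLevel n F 𝔫).comap (GLn.ofFinite n F) := by
  rw [mem_comap_principalCongruenceLevel_iff_localComponent]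
  intro v
  rw [map_mul, map_inv, localComponent_unitPart, localComponent_unitPart, ← map_inv, ← map_mul]
  set eb : (v.adicCompletion F)ˣ :=
    Units.map (algebraMap F (v.adicCompletion F) : F →* v.adicCompletion F) (unitOf b hb) *
      ((uniformizerAt v) ^ ordAt v b)⁻¹ with heb
  set ec : (v.adicCompletion F)ˣ :=
    Units.map (algebraMap F (v.adicCompletion F) : F →* v.adicCompletion F) (unitOf c hc) *
      ((uniformizerAt v) ^ ordAt v c)⁻¹ with hec
  have hveb : Valued.v (eb : v.adicCompletion F) = 1 := valued_unitPart b hb v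
  have hvec : Valued.v (ec : v.adicCompletion F) = 1 := valued_unitPart c hc v
  change glDiagonal n (v.adicCompletion F) (fun _ => ec⁻¹ * eb) ∈ _
  have hve : Valued.v ((ec⁻¹ * eb : (v.adicCompletion F)ˣ) : v.adicCompletion F) = 1 := by
    rw [Units.val_mul, map_mul, Units.val_inv_eq_inv_val, map_inv₀, hveb, hvec, inv_one, mul_one]
  have hve' : Valued.v (((ec⁻¹ * eb)⁻¹ : (v.adicCompletion F)ˣ) : v.adicCompletion F) = 1 := by
    rw [Units.val_inv_eq_inv_val, map_inv₀, hve, inv_one]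
  refine glDiagonal_const_mem_valuedCongruenceSubgroup hve.le hve'.le ?_
  by_cases hv : v.asIdeal ∣ 𝔫
  · -- `v ∤ b c`: the uniformiser powers are trivial and `e_v = b / c ≡ 1 (mod 𝔫_v)`
    have hvb : ordAt v b = 0 := by
      by_contra h
      exact hb𝔫 v ((ordAt_ne_zero_iff v hb).1 h) hv
    have hvc : ordAt v c = 0 := by
      by_contra h
      exact hc𝔫 v ((ordAt_ne_zero_iff v hc).1 h) hv
    have hc0 : algebraMap F (v.adicCompletion F) (c : F) ≠ 0 := by
      rw [map_ne_zero]; exact_mod_cast hc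
    have hcv : Valued.v (algebraMap F (v.adicCompletion F) (c : F)) = 1 := by
      rw [valued_algebraMap_eq v hc, hvc, Nat.cast_zero, neg_zero, WithZero.exp_zero]
    have he : ((ec⁻¹ * eb : (v.adicCompletion F)ˣ) : v.adicCompletion F) =
        algebraMap F (v.adicCompletion F) (b : F) / algebraMap F (v.adicCompletion F) (c : F) := by
      simp only [heb, hec, hvb, hvc, pow_zero, inv_one, mul_one]
      rw [Units.val_mul, Units.val_inv_eq_inv_val, Units.coe_map, Units.coe_map, MonoidHom.coe_coe,
        div_eq_mul_inv, mul_comm]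
      rfl
    rw [he, div_sub_one hc0, map_div₀, hcv, div_one, ← map_sub,
      show algebraMap F (v.adicCompletion F) ((b : F) - c) = (((b : F) - c : F) : v.adicCompletion F) from rfl,
      HeightOneSpectrum.valuedAdicCompletion_eq_valuation']
    exact valuation_sub_le_idealRadius h𝔫 hbc v
  · rw [idealRadius_eq_one_of_not_dvd h𝔫 hv]
    exact (Valued.v.map_sub _ _).trans (max_le hve.le (by rw [Valuation.map_one]))

/-- **The central eigensystem is a Größencharakter** (`E`-valued form).  For `ξ ≠ 0` with
`T_{w,n} ξ = a(w) ξ` for `w ∉ S`, `K_f(𝔫) ≤ U`, and non-zero `b, c ∈ 𝓞 F` prime to `S` and to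
`𝔫` with `b ≡ c (mod 𝔫)`: `A(b) · ω_wt(c) = A(c) · ω_wt(b)`, `A(x) = ∏_{w ∣ x} a(w)^{ord_w x}`.
[cite: Harder1987, §2] -/
theorem centralEigensystem_idealPow_mul_eq {𝔫 : Ideal (𝓞 F)} (h𝔫 : 𝔫 ≠ 0)
    (hU : (principalCongruenceLevel n F 𝔫).comap (GLn.ofFinite n F) ≤ U)
    (S : Set (HeightOneSpectrum (𝓞 F))) {ξ : cohomology E F n wt U q} (hξ : ξ ≠ 0)
    (a : HeightOneSpectrum (𝓞 F) → E)
    (heig : ∀ w, w ∉ S → heckeOp E F n wt U q (heckeElement n F w n) ξ = a w • ξ)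
    {b c : 𝓞 F} (hb : b ≠ 0) (hc : c ≠ 0)
    (hbS : ∀ w, w.asIdeal ∣ Ideal.span {b} → w ∉ S ∧ ¬ w.asIdeal ∣ 𝔫)
    (hcS : ∀ w, w.asIdeal ∣ Ideal.span {c} → w ∉ S ∧ ¬ w.asIdeal ∣ 𝔫)
    (hbc : b - c ∈ 𝔫) :
    eigenvalueProd a b hb * centralWeight (E := E) n wt (unitOf c hc) =
      eigenvalueProd a c hc * centralWeight (E := E) n wt (unitOf b hb) := by
  set ub : FiniteAdelicGL n F := globalEmbedding n F (Matrix.GeneralLinearGroup.scalar (Fin n) (unitOf b hb)) *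
    (centralIdeleOf b hb)⁻¹ with hub
  set uc : FiniteAdelicGL n F := globalEmbedding n F (Matrix.GeneralLinearGroup.scalar (Fin n) (unitOf c hc)) *
    (centralIdeleOf c hc)⁻¹ with huc
  have hub_c : ub ∈ Subgroup.center _ :=
    mul_mem (globalEmbedding_scalar_mem_center _) (inv_mem (centralIdeleOf_mem_center b hb))
  have huc_c : uc ∈ Subgroup.center _ :=
    mul_mem (globalEmbedding_scalar_mem_center _) (inv_mem (centralIdeleOf_mem_center c hc))
  have hk_U : uc⁻¹ * ub ∈ U :=
    hU (unitPart_quotient_mem h𝔫 hb hc (fun w hw => (hbS w hw).2) (fun w hw => (hcS w hw).2) hbc)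
  have hk_c : uc⁻¹ * ub ∈ Subgroup.center _ := mul_mem (inv_mem huc_c) hub_c
  -- compare `T_{u_b} ξ` and `T_{u_c} ξ`
  have h5 : heckeOp E F n wt U q ub ξ = heckeOp E F n wt U q uc ξ := by
    conv_lhs => rw [show ub = uc * (uc⁻¹ * ub) by group]
    rw [heckeOp_mul_of_mem_center E F n wt U q huc_c hk_c,
      heckeOp_eq_self_of_mem_center_of_mem E F n wt U q hk_c hk_U]
  rw [hub, huc, heckeOp_unitPart_apply hξ heig b hb fun w hw => (hbS w hw).1,
    heckeOp_unitPart_apply hξ heig c hc fun w hw => (hcS w hw).1] at h5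
  set Ab := eigenvalueProd a b hb
  set Ac := eigenvalueProd a c hc
  set ωb := centralWeight (E := E) n wt (unitOf b hb)
  set ωc := centralWeight (E := E) n wt (unitOf c hc)
  have h6 : ωb * Ab⁻¹ = ωc * Ac⁻¹ := by
    have h := sub_eq_zero.2 h5
    rw [← sub_smul, smul_eq_zero] at h
    exact sub_eq_zero.1 (h.resolve_right hξ)
  have hAb0 : Ab ≠ 0 := eigenvalueProd_ne_zero hξ heig b hb fun w hw => (hbS w hw).1
  have hAc0 : Ac ≠ 0 := eigenvalueProd_ne_zero hξ heig c hc fun w hw => (hcS w hw).1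
  calc Ab * ωc = Ab * ωc * (Ac⁻¹ * Ac) := by rw [inv_mul_cancel₀ hAc0, mul_one]
    _ = Ab * Ac * (ωc * Ac⁻¹) := by ring
    _ = Ab * Ac * (ωb * Ab⁻¹) := by rw [h6]
    _ = Ac * ωb * (Ab * Ab⁻¹) := by ring
    _ = Ac * ωb := by rw [mul_inv_cancel₀ hAb0, mul_one]

end ParallelWeight

end Literature.NumberTheory.Automorphic
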